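import Mathlib

/-!
# SoloBlind — tangency nodes of the special conic-bundle divisor at ψ = ±10

Setting (solo-blind programme, session s154).  `X_ψ = {x₀⁶+⋯+x₅⁶ + ψ·x₀x₁x₂x₃x₄x₅ = 0} ⊂ ℙ⁵` is the
Dwork sextic pencil and `Z_{N,ψ} = X_ψ ∩ V(Q_N)`, `Q_N = x₀x₁ + x₂x₃ - x₄x₅`, is the divisor lying over
the special line `N = {y₁ + y₂ = y₃}` of the plane of the invariants `yᵢ = x_{2i} x_{2i+1}`.
Writing `y = (1, t, 1+t)` on `N`, the six branch lines of the fibre over `t` are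
`X = ±a, Y = ±b, X + Y = c ± d` with `(a,b,c,d) = (2, 2t³, -ψ t(1+t), 2(1+t)³)`.

A point of `Z_{N,ψ}` with all `yᵢ ≠ 0` is singular iff it lies over a triple point of the line
arrangement, i.e. `E1 : 2ε₁ + 2ε₂t³ + 2ε₃(1+t)³ + ψ t(1+t) = 0` for signs `εᵢ`, AND the line `N`
is tangent there to that triple-point curve, i.e. `E2 : 6ε₁ - 6ε₂t² + ψ(t²-1) = 0`.
This file certifies, by pure polynomial algebra:

* `tangency_elim` : `(t²-1)·E1 - t(1+t)·E2` is `ψ`-free and factors through `(1+t)`;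
* `tangency_case_mmm`, `tangency_case_pmp`, `tangency_case_mpp` : for `ψ ≠ -6`, `t ≠ -1`, `t ≠ 0`
  the three sign patterns that occur force `ψ = 10` and `t ∈ {1, -1/2, -2}` respectively
  (the mirror patterns give `ψ = -10`; the remaining two patterns give the singular members `ψ = ±6`);
* `sum_abcd_at_ten` : at `ψ = 10`, `a+b+c+d = 4(t-1)²(t+1)` — the triple-point function of the
  pattern `(-,-,-)` restricted to `N` has a double root at `t = 1` (tangency);
* `tangencyNode_on_quadric`, `tangencyNode_F`, `tangencyNode_grad` : the explicit point
  `z = (1 : -1 : 1 : -1 : s : -s)`, `s² = 2`, lies on `V(Q_N)`, lies on `X_ψ` iff `ψ = 10`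
  (`F_ψ(z) = 20 - 2ψ`), and at `ψ = 10` satisfies `∇F(z) = 14 · ∇Q_N(z)`, so it is a singular point of
  `Z_{N,10}` (one of the 324 "tangency nodes"; the Hessian there is nondegenerate, det = 3456², checked
  in exact arithmetic over `ℚ(√2)` outside Lean).

No `sorry`, Mathlib only.
-/

namespace Summit.HodgeConjecture.HodgeConjecture.Theorems

/-- The combination `(t²-1)·E1 - t(1+t)·E2` of the triple-point equation `E1` and the tangency
equation `E2` does not involve `ψ` and is divisible by `1+t`. -/
theorem tangency_elim (e₁ e₂ e₃ t ψ : ℝ) :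
    (t ^ 2 - 1) * (2 * e₁ + 2 * e₂ * t ^ 3 + 2 * e₃ * (1 + t) ^ 3 + ψ * t * (1 + t))
      - t * (1 + t) * (6 * e₁ - 6 * e₂ * t ^ 2 + ψ * (t ^ 2 - 1))
      = (1 + t) * ((t - 1) * (2 * e₁ + 2 * e₂ * t ^ 3 + 2 * e₃ * (1 + t) ^ 3)
          - t * (6 * e₁ - 6 * e₂ * t ^ 2)) := by
  ring

/-- Sign pattern `(ε₁,ε₂,ε₃) = (-1,-1,-1)`: the triple-point and tangency equations force `t = 1`
and `ψ = 10` (for `ψ ≠ -6`, `t ≠ -1`). -/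
theorem tangency_case_mmm (t ψ : ℝ)
    (hE1 : 2 * (-1) + 2 * (-1) * t ^ 3 + 2 * (-1) * (1 + t) ^ 3 + ψ * t * (1 + t) = 0)
    (hE2 : 6 * (-1) - 6 * (-1) * t ^ 2 + ψ * (t ^ 2 - 1) = 0)
    (hψ : ψ ≠ -6) (ht : t ≠ -1) : t = 1 ∧ ψ = 10 := by
  have h1 : (t - 1) * ((t + 1) * (ψ + 6)) = 0 := by linear_combination hE2
  have hψ' : ψ + 6 ≠ 0 := fun h => hψ (by linarith)
  have ht' : t + 1 ≠ 0 := fun h => ht (by linarith)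
  have hprod : (t + 1) * (ψ + 6) ≠ 0 := mul_ne_zero ht' hψ'
  have ht1 : t - 1 = 0 := by
    rcases mul_eq_zero.mp h1 with h | h
    · exact h
    · exact absurd h hprod
  have ht1' : t = 1 := by linarith
  subst ht1'
  constructor
  · rfl
  · linear_combination hE1 / 2

/-- Sign pattern `(ε₁,ε₂,ε₃) = (1,-1,1)`: the two equations force `t = -1/2` and `ψ = 10`
(for `t ≠ -1`). -/
theorem tangency_case_pmp (t ψ : ℝ)
    (hE1 : 2 * 1 + 2 * (-1) * t ^ 3 + 2 * 1 * (1 + t) ^ 3 + ψ * t * (1 + t) = 0)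
    (hE2 : 6 * 1 - 6 * (-1) * t ^ 2 + ψ * (t ^ 2 - 1) = 0)
    (ht : t ≠ -1) : t = -1 / 2 ∧ ψ = 10 := by
  have key : (1 + t) * (-4 * (1 + 2 * t)) = 0 := by
    have := tangency_elim 1 (-1) 1 t ψ
    rw [hE1, hE2] at this
    linear_combination -this
  have ht' : 1 + t ≠ 0 := fun h => ht (by linarith)
  have h2 : -4 * (1 + 2 * t) = 0 := by
    rcases mul_eq_zero.mp key with h | h
    · exact absurd h ht'
    · exact h
  have ht2 : t = -1 / 2 := by linarith
  subst ht2
  constructor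
  · rfl
  · linear_combination (-4 / 3) * hE2

/-- Sign pattern `(ε₁,ε₂,ε₃) = (-1,1,1)`: the two equations force `t = -2` and `ψ = 10`
(for `t ≠ -1`, `t ≠ 0`). -/
theorem tangency_case_mpp (t ψ : ℝ)
    (hE1 : 2 * (-1) + 2 * 1 * t ^ 3 + 2 * 1 * (1 + t) ^ 3 + ψ * t * (1 + t) = 0)
    (hE2 : 6 * (-1) - 6 * 1 * t ^ 2 + ψ * (t ^ 2 - 1) = 0)
    (ht : t ≠ -1) (ht0 : t ≠ 0) : t = -2 ∧ ψ = 10 := by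
  have key : (1 + t) * (4 * t ^ 3 * (2 + t)) = 0 := by
    have := tangency_elim (-1) 1 1 t ψ
    rw [hE1, hE2] at this
    linear_combination -this
  have ht' : 1 + t ≠ 0 := fun h => ht (by linarith)
  have h2 : 4 * t ^ 3 * (2 + t) = 0 := by
    rcases mul_eq_zero.mp key with h | h
    · exact absurd h ht'
    · exact h
  have ht3 : t ^ 3 ≠ 0 := pow_ne_zero 3 ht0
  have h3 : 2 + t = 0 := by
    rcases mul_eq_zero.mp h2 with h | h
    · exact absurd (by linarith : t ^ 3 = 0) ht3
    · exact h
  have ht2 : t = -2 := by linarith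
  subst ht2
  constructor
  · rfl
  · linear_combination hE2 / 3

/-- At `ψ = 10` the sum `a+b+c+d = 2 + 2t³ - 10t(1+t) + 2(1+t)³` of the configuration, whose
vanishing says that the lines `X=-a`, `Y=-b`, `X+Y=c+d` are concurrent, has a double root at
`t = 1`: the special line `N` is tangent to this triple-point curve. -/
theorem sum_abcd_at_ten (t : ℝ) :
    2 + 2 * t ^ 3 - 10 * t * (1 + t) + 2 * (1 + t) ^ 3 = 4 * (t - 1) ^ 2 * (t + 1) := by
  ring

/-- The point `z = (1,-1,1,-1,s,-s)` (`s² = 2`) lies on the quadric `Q_N = x₀x₁ + x₂x₃ - x₄x₅`. -/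
theorem tangencyNode_on_quadric (s : ℝ) (hs : s ^ 2 = 2) :
    (1 : ℝ) * (-1) + 1 * (-1) - s * (-s) = 0 := by
  linear_combination hs

/-- At `z = (1,-1,1,-1,s,-s)` (`s² = 2`) the Dwork sextic `F_ψ = Σ xᵢ⁶ + ψ ∏ xᵢ` takes the value
`20 - 2ψ`; in particular `z ∈ X_ψ` iff `ψ = 10`. -/
theorem tangencyNode_F (s ψ : ℝ) (hs : s ^ 2 = 2) :
    (1 : ℝ) ^ 6 + (-1) ^ 6 + 1 ^ 6 + (-1) ^ 6 + s ^ 6 + (-s) ^ 6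
      + ψ * (1 * (-1) * 1 * (-1) * s * (-s)) = 20 - 2 * ψ := by
  linear_combination (2 * (s ^ 4 + 2 * s ^ 2 + 4) - ψ) * hs

/-- `z = (1,-1,1,-1,s,-s)` lies on `X_10`. -/
theorem tangencyNode_on_X10 (s : ℝ) (hs : s ^ 2 = 2) :
    (1 : ℝ) ^ 6 + (-1) ^ 6 + 1 ^ 6 + (-1) ^ 6 + s ^ 6 + (-s) ^ 6
      + 10 * (1 * (-1) * 1 * (-1) * s * (-s)) = 0 := by
  have := tangencyNode_F s 10 hs
  linarith

/-- At `ψ = 10` and `z = (1,-1,1,-1,s,-s)` (`s² = 2`) the gradient of `F` is `14` times the gradient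
of `Q_N`: componentwise `∂F/∂xᵢ = 6xᵢ⁵ + 10·∏_{j≠i} xⱼ` equals `14·∂Q_N/∂xᵢ` with
`∇Q_N = (x₁, x₀, x₃, x₂, -x₅, -x₄)`.  Hence `z` is a singular point of `Z_{N,10} = X_10 ∩ V(Q_N)`. -/
theorem tangencyNode_grad (s : ℝ) (hs : s ^ 2 = 2) :
    (6 * (1 : ℝ) ^ 5 + 10 * ((-1) * 1 * (-1) * s * (-s)) = 14 * (-1)) ∧
    (6 * (-1 : ℝ) ^ 5 + 10 * (1 * 1 * (-1) * s * (-s)) = 14 * 1) ∧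
    (6 * (1 : ℝ) ^ 5 + 10 * (1 * (-1) * (-1) * s * (-s)) = 14 * (-1)) ∧
    (6 * (-1 : ℝ) ^ 5 + 10 * (1 * (-1) * 1 * s * (-s)) = 14 * 1) ∧
    (6 * s ^ 5 + 10 * (1 * (-1) * 1 * (-1) * (-s)) = 14 * (-(-s))) ∧
    (6 * (-s) ^ 5 + 10 * (1 * (-1) * 1 * (-1) * s) = 14 * (-s)) := by
  refine ⟨?_, ?_, ?_, ?_, ?_, ?_⟩
  · linear_combination (-10) * hs
  · linear_combination 10 * hs
  · linear_combination (-10) * hs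
  · linear_combination 10 * hs
  · linear_combination (6 * s * (s ^ 2 + 2)) * hs
  · linear_combination (-(6 * s * (s ^ 2 + 2))) * hs

/-- Existence of a real `s` with `s² = 2`, so that the statements above are not vacuous. -/
theorem exists_sq_eq_two : ∃ s : ℝ, s ^ 2 = 2 :=
  ⟨Real.sqrt 2, Real.sq_sqrt (by norm_num)⟩

end Summit.HodgeConjecture.HodgeConjecture.Theorems
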